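import Summits.QuantumFields.YangMills.Theorems.BalabanStepParabolic.Negative.NoContinuityJunk
import Literature.MathematicalPhysics.QuantumFieldTheory.LatticeGaugeProofs

/-!
# `BalabanStepParabolic` — negative-side support X: the hypothesis `IsCompactSimpleLieGroup` is load-bearing for content, not truth

Support file for crux `stmt-QuantumFields-9684` (`ParabolicTrajectory.BalabanStepParabolic`), extracted from the
standing disprover's work file `Cruxes/BalabanStepParabolic/Disproof.lean` §H (cycle 2). Tree objects only.

Load-bearing analysis of the crux's only explicit hypothesis. Dropping `IsCompactSimpleLieGroup G` does NOT make
the statement false — it trivialises it: for a one-element gauge group (`Subsingleton G`; admitted by `LatticeRep`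
through the one-dimensional trivial representation `unitLatticeRep`, excluded by `IsCompactSimpleLieGroup`, which
demands a non-commuting pair) all lattice configurations coincide, every centred smeared field vanishes
(`smeared_centred_eq_zero_of_subsingleton`), the centred Wilson `n`-point functions are the constants `1`/`0`
(`wilsonCentredSchwinger_of_subsingleton`), and the FULL structure `BalabanBanachStep G r M` is inhabited for EVERY
`M ≥ 2`, odd `M` included (`trivialGroupStep`, `nonempty_of_subsingleton`, `balabanStep_punit`). So there is no
`_false_without_IsCompactSimpleLieGroup` theorem; the hypothesis's role is exactly to exclude junk gauge groups.
-/

namespace Summit.QuantumFields.YangMills.Theorems.BalabanStepParabolic.Negative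

open scoped SchwartzMap
open MeasureTheory Filter Topology
open Literature.MathematicalPhysics.QuantumFieldTheory Literature.MathematicalPhysics.AQFT
open Literature.MathematicalPhysics.QuantumLattice

noncomputable section

section TrivialGroup

variable {G : Type} [Group G] [TopologicalSpace G] [IsTopologicalGroup G] [CompactSpace G]
  [MeasurableSpace G] [BorelSpace G] [Subsingleton G] (r : LatticeRep G)

/-- For a trivial (one-element) gauge group every centred smeared field vanishes identically:
all configurations coincide, so every observable equals its own torus mean. [folklore] -/
theorem smeared_centred_eq_zero_of_subsingleton (β : ℝ) (L : ℕ) (O : YMSpecies G) (c : ℝ)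
    (f : 𝓢(EuclideanSpace ℝ (Fin 4), ℝ)) (U : GaugeConfig 4 (2 * L + 1) G) :
    smearedLatticeField O.F (Literature.Probability.LatticeModels.box 4 L) 1 c
      (wilsonTorusMean r.ρ β L O.F) f (torusLift (2 * L + 1) U) = 0 := by
  haveI := isProbabilityMeasure_wilsonMeasure (d := 4) (L := 2 * L + 1) r.ρ r.continuous β
  have hconst : ∀ V W : LGConfig 4 G, O.F V = O.F W := fun V W => congrArg O.F (Subsingleton.elim V W)
  have hmean : wilsonTorusMean r.ρ β L O.F = O.F (torusLift (2 * L + 1) U) := by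
    unfold wilsonTorusMean
    rw [show (fun V : GaugeConfig 4 (2 * L + 1) G => O.F (torusLift (2 * L + 1) V)) =
        fun _ => O.F (torusLift (2 * L + 1) U) from funext fun V => hconst _ _]
    rw [integral_const, probReal_univ, one_smul]
  unfold smearedLatticeField
  refine mul_eq_zero_of_right _ (Finset.sum_eq_zero fun x _ => ?_)
  rw [hmean, hconst (configShift (-x) (torusLift (2 * L + 1) U)) (torusLift (2 * L + 1) U), sub_self,
    mul_zero]

/-- For a trivial gauge group the centred Wilson `n`-point functions are `1` (`n = 0`) or `0`. [folklore] -/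
theorem wilsonCentredSchwinger_of_subsingleton (β : ℝ) (L n : ℕ) (c : YMSpecies G → ℝ)
    (σ : Fin n → YMSpecies G) (f : Fin n → 𝓢(EuclideanSpace ℝ (Fin 4), ℝ)) :
    wilsonCentredSchwinger r.ρ β L c n σ f = if n = 0 then 1 else 0 := by
  haveI := isProbabilityMeasure_wilsonMeasure (d := 4) (L := 2 * L + 1) r.ρ r.continuous β
  by_cases hn : n = 0
  · subst hn
    rw [if_pos rfl, wilsonCentredSchwinger_zero]
    exact probReal_univ
  · rw [if_neg hn]
    obtain ⟨k, rfl⟩ := Nat.exists_eq_succ_of_ne_zero hn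
    unfold wilsonCentredSchwinger
    have hzero : ∀ U : GaugeConfig 4 (2 * L + 1) G,
        (∏ i : Fin (k + 1), smearedLatticeField (σ i).F (Literature.Probability.LatticeModels.box 4 L) 1
          (c (σ i)) (wilsonTorusMean r.ρ β L (σ i).F) (f i) (torusLift (2 * L + 1) U)) = 0 :=
      fun U => Finset.prod_eq_zero (Finset.mem_univ (0 : Fin (k + 1)))
        (smeared_centred_eq_zero_of_subsingleton r β L (σ 0) _ (f 0) U)
    simp_rw [hzero, integral_zero]

variable (M : ℕ) (hM : 2 ≤ M)

/-- `‖(1/2) • id‖ ≤ 1/2` on `ℝ`. [folklore] -/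
theorem norm_half_id_le' : ‖(1 / 2 : ℝ) • ContinuousLinearMap.id ℝ ℝ‖ ≤ 1 / 2 := by
  refine (norm_smul_le (1 / 2 : ℝ) (ContinuousLinearMap.id ℝ ℝ)).trans ?_
  have h : ‖ContinuousLinearMap.id ℝ ℝ‖ ≤ 1 := ContinuousLinearMap.norm_id_le
  have : ‖(1 / 2 : ℝ)‖ = 1 / 2 := by norm_num
  rw [this]
  linarith [norm_nonneg (ContinuousLinearMap.id ℝ ℝ)]

/-- `((1/2) • id) y = (1/2) • y` on `ℝ`. [folklore] -/
theorem half_id_apply' (y : ℝ) : ((1 / 2 : ℝ) • ContinuousLinearMap.id ℝ ℝ) y = (1 / 2 : ℝ) • y := rfl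

include hM in
/-- **The trivial-group inhabitant of the FULL structure, every `M ≥ 2`** (odd included): thin
chart, junk parabolic flow, and the CONSTANT realisation functional `1`/`0` — which IS the genuine
Wilson data when the gauge group has one element. [folklore] -/
def trivialGroupStep : BalabanBanachStep G r M where
  E := ℝ
  φ g _ := φJ M g
  Ψ _ y := (1 / 2 : ℝ) • y
  A := (1 / 2 : ℝ) • ContinuousLinearMap.id ℝ ℝ
  b := Real.log M
  θ := 1 / 2
  C := 1
  δ := 1
  b_pos := Real.log_pos (by exact_mod_cast hM)
  θ_nonneg := by norm_num
  θ_lt_one := by norm_num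
  C_pos := one_pos
  δ_pos := one_pos
  norm_A_le := norm_half_id_le'
  remainder g y _ _ := by
    constructor
    · simp only [φJ, sub_self, abs_zero]; positivity
    · rw [half_id_apply', sub_self, norm_zero]; positivity
  lipschitz_fibre g y y' _ _ _ := by
    constructor
    · simp only [sub_self, abs_zero]; positivity
    · have : (1 / 2 : ℝ) • y - (1 / 2 : ℝ) • y' -
          ((1 / 2 : ℝ) • ContinuousLinearMap.id ℝ ℝ) (y - y') = 0 := by
        rw [half_id_apply', smul_sub]
        abel
      rw [this, norm_zero]; positivity
  lipschitz_base g g' y _ _ _ := by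
    constructor
    · have : φJ M g - φJ M g' - (g - g') - Real.log M * (g ^ 3 - g' ^ 3) = 0 := by
        simp only [φJ]; ring
      rw [this, abs_zero]; positivity
    · simp only [sub_self, norm_zero]; positivity
  b₀ := 1
  b_eq := (one_mul _).symm
  R := 1
  δ_le_R := le_rfl
  θ' := 1 / 2
  θ'_nonneg := by norm_num
  θ'_lt_one := by norm_num
  contraction g y y' _ _ _ := by
    rw [← smul_sub, norm_smul]; norm_num
  remainder_basin g y _ _ := by simp only [φJ, sub_self, abs_zero]; positivity
  yW _ := 1
  g₀ := 1
  g₀_pos := one_pos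
  continuousOn_yW := continuousOn_const
  norm_yW_le _ _ := by simp
  betaOf g := 1 / g ^ 2
  strictAntiOn_betaOf := strictAntiOn_one_div_sq
  continuousOn_betaOf := continuousOn_one_div_sq
  κ := 1
  κ_pos := one_pos
  K := 0
  betaOf_sub_le g _ := by simp
  c _ _ := 1
  c_curvature _ := rfl
  expect _ _ n _ _ := if n = 0 then 1 else 0
  expect_step _ _ _ _ _ _ _ _ := rfl
  expect_wilson g _ L n σ f := (wilsonCentredSchwinger_of_subsingleton r _ L n _ σ f).symm
  continuousOn_expect _ _ _ _ _ := continuousOn_const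

include hM in
/-- **`IsCompactSimpleLieGroup` is load-bearing for CONTENT, not for truth.** Dropping it from the
crux does not make the statement false — at the trivial gauge group (`Subsingleton G`, admitted by
`LatticeRep` with the one-dimensional trivial representation but excluded by
`IsCompactSimpleLieGroup`, which demands a non-commuting pair) the FULL structure is inhabited for
EVERY `M ≥ 2`, odd `M` included, by constants. So no `_false_without_` theorem exists for this
hypothesis; its role is to exclude junk gauge groups, exactly as the route intends. [folklore] -/
theorem nonempty_of_subsingleton : Nonempty (BalabanBanachStep G r M) := ⟨trivialGroupStep r M hM⟩

end TrivialGroup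

/-- The trivial group carries a lattice representation (`N = 1`, `ρ ≡ 1`), so the statement below is
not vacuous. [folklore] -/
def unitLatticeRep : LatticeRep PUnit.{1} where
  N := 1
  ρ := 1
  continuous := continuous_const
  injective := fun _ _ _ => Subsingleton.elim _ _
  mem_unitary := fun _ => by simp [MonoidHom.one_apply]

/-- **The crux WITHOUT `IsCompactSimpleLieGroup` holds at the trivial group** (witnessing that the
hypothesis is not load-bearing for truth): every block factor `M ≥ 2`. [folklore] -/
theorem balabanStep_punit (M : ℕ) (hM : 2 ≤ M) :
    letI : MeasurableSpace PUnit.{1} := borel PUnit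
    haveI : BorelSpace PUnit.{1} := ⟨rfl⟩
    ∀ r : LatticeRep PUnit.{1}, Nonempty (BalabanBanachStep PUnit r M) := by
  intro r
  exact @nonempty_of_subsingleton PUnit _ _ _ _ (borel PUnit) (@BorelSpace.mk PUnit _ (borel PUnit) rfl)
    _ r M hM

end

end Summit.QuantumFields.YangMills.Theorems.BalabanStepParabolic.Negative
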